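import Summits.Ventures.QEC.Thresholds.DepolarizingThresholdConverses
import HarnessLib

/-!
# Planar surface codes: the `X ↔ Z` exchange is a re-indexing ⇒ `1/3 ≤ y_c ≤ 1/2` and `p₀(3) ≤ p_c ≤ 1/4`
# per sector (every decoder); toric codes: the `X`-sector code-capacity ceiling `1/4`

Venture QEC, `Summits/Ventures/QEC/Thresholds/` (LADDER-QEC rung Q5; qec-lit-2 gen 4). HONEST FRAMING.
`ThresholdConverses.lean` gave the planar surface codes `planarHGPCode k = HGP(H_k, H_k)` (`H_k` the
`(k+1) × (k+2)` repetition parity-check matrix) only the two-sector SUM ceilings (`y₀ + y₀' ≤ 1`, `p₀ + p₀' ≤ 1/2`),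
noting that the sector symmetry is a reflection of the lattice. Since BOTH factors of the hypergraph product are the
same matrix, that reflection is — exactly as for the toric codes `HGP(circ, circ)` — the coordinate swap of checks
and qubits: `H^Z (j,i) q = H^X (i,j) (swap q)` (`planarHGPCode_HZ_eq_submatrix`), so the `X ↔ Z` exchanged planar
code IS the planar code re-indexed (`planarHGPCode_swap_eq_reindex`, via `CSSCode.eq_reindex_of_submatrix`), and
`CSSEquivalenceNoise.lean` transports erasure families and decoders. Consequences (all for EVERY decoder of the
sector, maximum likelihood included, unless a floor names its decoder class):

* `planarErasureFamily' = planarErasureFamily` (the two sectors' erasure families coincide);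
  **`1/3 ≤ y_c ≤ 1/2`** for either sector (`planar_erasure_accuracyThreshold_mem`, `…_mem'`);
* **`p_c ≤ 1/4` for EVERY decoder family**, either sector (`planar_z_capacity_threshold_le_quarter`,
  `planar_x_capacity_threshold_le_quarter`), and `p₀(3) ≤ p_c ≤ 1/4` under minimum-weight decoding
  (`planar_z_capacity_accuracyThreshold_mem`);
* depolarizing noise, sector-wise minimum-weight decoding: `(3/2)·p₀(3) ≤ p_c^depol ≤ 3/8`
  (`planar_depolarizing_accuracyThreshold_mem`);
* toric codes, the `X`-SECTOR code-capacity ceiling `p_c ≤ 1/4` for every decoder family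
  (`toricHGP_x_capacity_threshold_le_quarter`; `ThresholdConverses.lean` had the `Z`-sector), by transporting an
  `X`-decoder back to a `Z`-decoder along the inverse re-indexing.

Printed values (VALIDATED column, not theorems): planar/toric `y_c = 1/2` (bond percolation), optimal `p_c ≈ .109`,
MWPM `≈ .103`. Kernel axioms only; no named fact; no `native_decide`; no new definition.

## References

* [TillichZemor2014] J.-P. Tillich, G. Zémor, IEEE Trans. IT 60 (2014) 1193, §3 (planar code as a product code).
* [StaceBarrettDoherty2009] T. M. Stace, S. D. Barrett, A. C. Doherty, PRL 102 (2009) 200501, pp. 1–2.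
* [RichardsonUrbanke2008] T. Richardson, R. Urbanke, *Modern Coding Theory*, Lemma 4.78 (Erasure Decomposition).
* [DumerKovalevPryadko2015] I. Dumer, A. A. Kovalev, L. P. Pryadko, PRL 115 (2015) 050502, Thm 2, p. 5.
* [DennisEtAl2002] E. Dennis, A. Kitaev, A. Landahl, J. Preskill, J. Math. Phys. 43 (2002) 4452, §4.1, §4.6.
-/

noncomputable section

namespace Summit.Ventures.QEC.Thresholds

open Filter Topology Finset Matrix
open Literature.InformationTheory.QuantumCodes

/-! ### Planar surface codes: the exchange is the coordinate swap -/

section Planar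

/-- **`H^Z (j,i) q = H^X (i,j) (swap q)`** for `HGP(H, H)`: the planar code's `Z`-check matrix is its `X`-check
matrix re-indexed by swapping the two coordinates of checks and of qubits (both qubit blocks).
[cite: TillichZemor2014, §3 (the planar code as the product of a repetition code with its transpose)] -/
theorem planarHGPCode_HZ_eq_submatrix (k : ℕ) :
    (planarHGPCode k).HZ = (planarHGPCode k).HX.submatrix (Equiv.prodComm (Fin (k + 2)) (Fin (k + 1)))
      (Equiv.sumCongr (Equiv.prodComm (Fin (k + 2)) (Fin (k + 2))) (Equiv.prodComm (Fin (k + 1)) (Fin (k + 1)))) := by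
  ext ⟨i, j⟩ q
  rcases q with ⟨a, b⟩ | ⟨c, d⟩
  · simp [HGP.code_HX, HGP.code_HZ, HGP.HX_eq, HGP.HZ_eq, Matrix.fromCols_apply_inl, Matrix.kroneckerMap_apply,
      Matrix.one_apply, mul_comm]
  · simp [HGP.code_HX, HGP.code_HZ, HGP.HX_eq, HGP.HZ_eq, Matrix.fromCols_apply_inr, Matrix.kroneckerMap_apply,
      Matrix.one_apply, Matrix.transpose_apply, mul_comm]

/-- And `H^X (i,j) q = H^Z (j,i) (swap q)`. [cite: TillichZemor2014, §3] -/
theorem planarHGPCode_HX_eq_submatrix (k : ℕ) :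
    (planarHGPCode k).HX = (planarHGPCode k).HZ.submatrix (Equiv.prodComm (Fin (k + 1)) (Fin (k + 2)))
      (Equiv.sumCongr (Equiv.prodComm (Fin (k + 2)) (Fin (k + 2))) (Equiv.prodComm (Fin (k + 1)) (Fin (k + 1)))) := by
  ext ⟨i, j⟩ q
  rcases q with ⟨a, b⟩ | ⟨c, d⟩
  · simp [HGP.code_HX, HGP.code_HZ, HGP.HX_eq, HGP.HZ_eq, Matrix.fromCols_apply_inl, Matrix.kroneckerMap_apply,
      Matrix.one_apply, mul_comm]
  · simp [HGP.code_HX, HGP.code_HZ, HGP.HX_eq, HGP.HZ_eq, Matrix.fromCols_apply_inr, Matrix.kroneckerMap_apply,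
      Matrix.one_apply, Matrix.transpose_apply, mul_comm]

/-- **The `X ↔ Z` exchange of the planar surface code is a re-indexing of the planar surface code.**
[cite: TillichZemor2014, §3 (the planar code as the product of a repetition code with its transpose)] -/
theorem planarHGPCode_swap_eq_reindex (k : ℕ) :
    (planarHGPCode k).swap =
      (planarHGPCode k).reindex (Equiv.prodComm (Fin (k + 2)) (Fin (k + 1))).symm
        (Equiv.prodComm (Fin (k + 1)) (Fin (k + 2))).symm
        (Equiv.sumCongr (Equiv.prodComm (Fin (k + 2)) (Fin (k + 2)))
          (Equiv.prodComm (Fin (k + 1)) (Fin (k + 1)))).symm :=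
  CSSCode.eq_reindex_of_submatrix (C := planarHGPCode k) (C' := (planarHGPCode k).swap)
    (planarHGPCode_HZ_eq_submatrix k) (planarHGPCode_HX_eq_submatrix k)

/-- Conversely the planar code is a re-indexing of its exchange (used to transport `X`-decoders back to
`Z`-decoders). [cite: TillichZemor2014, §3] -/
theorem planarHGPCode_eq_swap_reindex (k : ℕ) :
    planarHGPCode k =
      (planarHGPCode k).swap.reindex (Equiv.prodComm (Fin (k + 1)) (Fin (k + 2))).symm
        (Equiv.prodComm (Fin (k + 2)) (Fin (k + 1))).symm
        (Equiv.sumCongr (Equiv.prodComm (Fin (k + 2)) (Fin (k + 2)))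
          (Equiv.prodComm (Fin (k + 1)) (Fin (k + 1)))).symm :=
  CSSCode.eq_reindex_of_submatrix (C := (planarHGPCode k).swap) (C' := planarHGPCode k)
    (planarHGPCode_HX_eq_submatrix k) (planarHGPCode_HZ_eq_submatrix k)

/-- **The two sectors of the planar code have the same erasure family** (pointwise).
[cite: StaceBarrettDoherty2009, p. 2 (losses affect both logical operators symmetrically)] -/
theorem planar_xErasureFamily_eq (k : ℕ) (y : ℝ) :
    xErasureFamily (fun k => planarHGPCode k) k y = zErasureFamily (fun k => planarHGPCode k) k y := by
  rw [xErasureFamily_eq_swap]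
  change ErasureDecoder.uncorrectableProb {x | (planarHGPCode k).swap.HX *ᵥ x = 0}
      ((planarHGPCode k).swap.rowSpZ : Set _) y =
    ErasureDecoder.uncorrectableProb {x | (planarHGPCode k).HX *ᵥ x = 0} ((planarHGPCode k).rowSpZ : Set _) y
  rw [planarHGPCode_swap_eq_reindex, CSSCode.uncorrectableProb_reindex]

/-- Hence lit-2's two planar erasure families coincide: `planarErasureFamily' = planarErasureFamily`.
[cite: StaceBarrettDoherty2009, p. 2] -/
theorem planarErasureFamily'_eq : planarErasureFamily' = planarErasureFamily := by
  rw [← zErasureFamily_planarHGPCode, ← xErasureFamily_planarHGPCode]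
  funext k y
  exact planar_xErasureFamily_eq k y

/-- **Planar erasure threshold `≤ 1/2`** (first sector): no number above `1/2` can be certified as an erasure
threshold lower bound of the planar surface codes (floor `1/3` in `PlanarSurfaceCodeThresholds.lean`).
[cite: StaceBarrettDoherty2009, p. 1 (abstract) and p. 2 (no-cloning bound)] -/
theorem planar_erasure_threshold_le_half {a : ℝ} (ha : IsThresholdLowerBound planarErasureFamily a) : a ≤ 1 / 2 :=
  erasure_threshold_le_half_of_symm (fun k => planarHGPCode k) planarHGPCode_k_pos
    (fun k y => planar_xErasureFamily_eq k y) ha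

/-- **Planar erasure threshold `≤ 1/2`**, second sector. [cite: StaceBarrettDoherty2009, p. 1 (abstract) and p. 2] -/
theorem planar_erasure_threshold_le_half' {a : ℝ} (ha : IsThresholdLowerBound planarErasureFamily' a) :
    a ≤ 1 / 2 := by
  rw [planarErasureFamily'_eq] at ha
  exact planar_erasure_threshold_le_half ha

/-- **`1/3 ≤ y_c ≤ 1/2` for the planar surface codes' erasure accuracy threshold** (first sector) — a certified
two-sided interval (printed value `0.5` by bond percolation, NOT proved).
[cite: StaceBarrettDoherty2009, p. 2 (p_loss < 0.5); DumerKovalevPryadko2015, p. 5 (y_c* = 1/3)] -/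
theorem planar_erasure_accuracyThreshold_mem :
    (1 / 3 : ℝ) ≤ accuracyThreshold planarErasureFamily ∧ accuracyThreshold planarErasureFamily ≤ 1 / 2 :=
  ⟨planar_erasure_accuracyThreshold_ge, planar_erasure_threshold_le_half (isThresholdLowerBound_accuracyThreshold _)⟩

/-- **`1/3 ≤ y_c ≤ 1/2`**, second sector. [cite: StaceBarrettDoherty2009, p. 2; DumerKovalevPryadko2015, p. 5] -/
theorem planar_erasure_accuracyThreshold_mem' :
    (1 / 3 : ℝ) ≤ accuracyThreshold planarErasureFamily' ∧ accuracyThreshold planarErasureFamily' ≤ 1 / 2 := by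
  rw [planarErasureFamily'_eq]
  exact planar_erasure_accuracyThreshold_mem

open Classical in
/-- **Transport of decoders**: every `Z`-decoder family `DZ` of the planar codes yields an `X`-decoder family
(`s ↦ DZ(s ∘ swap) ∘ swap`) with the same failure family. [cite: StaceBarrettDoherty2009, p. 2] -/
theorem planar_xFailureFamily_transport_eq (DZ : ∀ k, Decoder (PlanarCheck k → ZMod 2) (PlanarQubit k → ZMod 2)) :
    xFailureFamily (fun k => planarHGPCode k)
        (fun k => fun s' => DZ k (s' ∘ (Equiv.prodComm (Fin (k + 2)) (Fin (k + 1))).symm) ∘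
          (Equiv.sumCongr (Equiv.prodComm (Fin (k + 2)) (Fin (k + 2)))
            (Equiv.prodComm (Fin (k + 1)) (Fin (k + 1)))).symm.symm) =
      zFailureFamily (fun k => planarHGPCode k) DZ := by
  funext k p
  rw [xFailureFamily_eq_swap]
  change (∑ e ∈ univ.filter (fun e => ¬ Decoder.Corrects
        (fun s' => DZ k (s' ∘ (Equiv.prodComm (Fin (k + 2)) (Fin (k + 1))).symm) ∘
          (Equiv.sumCongr (Equiv.prodComm (Fin (k + 2)) (Fin (k + 2)))
            (Equiv.prodComm (Fin (k + 1)) (Fin (k + 1)))).symm.symm) (planarHGPCode k).swap.zSyndrome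
        ((planarHGPCode k).swap.rowSpZ : Set _) e), bernoulliWeight p (supp e)) =
    ∑ e ∈ univ.filter (fun e => ¬ (DZ k).Corrects (planarHGPCode k).zSyndrome
        ((planarHGPCode k).rowSpZ : Set _) e), bernoulliWeight p (supp e)
  rw [planarHGPCode_swap_eq_reindex]
  exact CSSCode.zFailure_reindex (planarHGPCode k) (Equiv.prodComm (Fin (k + 2)) (Fin (k + 1))).symm
    (Equiv.prodComm (Fin (k + 1)) (Fin (k + 2))).symm
    (Equiv.sumCongr (Equiv.prodComm (Fin (k + 2)) (Fin (k + 2)))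
      (Equiv.prodComm (Fin (k + 1)) (Fin (k + 1)))).symm (DZ k) p

open Classical in
/-- **Transport back**: every `X`-decoder family `DX` of the planar codes yields a `Z`-decoder family with the
same failure family. [cite: StaceBarrettDoherty2009, p. 2] -/
theorem planar_zFailureFamily_transport_eq (DX : ∀ k, Decoder (PlanarZCheck k → ZMod 2) (PlanarQubit k → ZMod 2)) :
    zFailureFamily (fun k => planarHGPCode k)
        (fun k => fun s' => DX k (s' ∘ (Equiv.prodComm (Fin (k + 1)) (Fin (k + 2))).symm) ∘
          (Equiv.sumCongr (Equiv.prodComm (Fin (k + 2)) (Fin (k + 2)))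
            (Equiv.prodComm (Fin (k + 1)) (Fin (k + 1)))).symm.symm) =
      xFailureFamily (fun k => planarHGPCode k) DX := by
  funext k p
  rw [xFailureFamily_eq_swap]
  have key := CSSCode.zFailure_reindex (planarHGPCode k).swap (Equiv.prodComm (Fin (k + 1)) (Fin (k + 2))).symm
    (Equiv.prodComm (Fin (k + 2)) (Fin (k + 1))).symm
    (Equiv.sumCongr (Equiv.prodComm (Fin (k + 2)) (Fin (k + 2)))
      (Equiv.prodComm (Fin (k + 1)) (Fin (k + 1)))).symm (DX k) p
  rw [← planarHGPCode_eq_swap_reindex] at key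
  exact key

open Classical in
/-- **Planar code-capacity threshold `≤ 1/4` for EVERY decoder family** (first sector; maximum likelihood
included; floor `p₀(3)` for minimum-weight decoders in `PlanarSurfaceCodeThresholds.lean`).
[cite: RichardsonUrbanke2008, Lemma 4.78 (Erasure Decomposition Lemma); StaceBarrettDoherty2009, p. 2] -/
theorem planar_z_capacity_threshold_le_quarter (DZ : ∀ k, Decoder (PlanarCheck k → ZMod 2) (PlanarQubit k → ZMod 2))
    {a : ℝ} (ha : IsThresholdLowerBound (planarFailureFamily DZ) a) : a ≤ 1 / 4 := by
  have ha' : IsThresholdLowerBound (zFailureFamily (fun k => planarHGPCode k) DZ) a := ha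
  have hb : IsThresholdLowerBound (xFailureFamily (fun k => planarHGPCode k)
      (fun k => fun s' => DZ k (s' ∘ (Equiv.prodComm (Fin (k + 2)) (Fin (k + 1))).symm) ∘
          (Equiv.sumCongr (Equiv.prodComm (Fin (k + 2)) (Fin (k + 2)))
            (Equiv.prodComm (Fin (k + 1)) (Fin (k + 1)))).symm.symm)) a := by
    rw [planar_xFailureFamily_transport_eq]
    exact ha'
  have h := capacity_thresholds_add_le_half (fun k => planarHGPCode k) planarHGPCode_k_pos DZ _ ha' hb
  linarith

open Classical in
/-- **Planar code-capacity threshold `≤ 1/4` for EVERY decoder family**, second sector.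
[cite: RichardsonUrbanke2008, Lemma 4.78 (Erasure Decomposition Lemma); StaceBarrettDoherty2009, p. 2] -/
theorem planar_x_capacity_threshold_le_quarter (DX : ∀ k, Decoder (PlanarZCheck k → ZMod 2) (PlanarQubit k → ZMod 2))
    {b : ℝ} (hb : IsThresholdLowerBound (planarFailureFamily' DX) b) : b ≤ 1 / 4 := by
  have hb' : IsThresholdLowerBound (xFailureFamily (fun k => planarHGPCode k) DX) b := hb
  have ha : IsThresholdLowerBound (zFailureFamily (fun k => planarHGPCode k)
      (fun k => fun s' => DX k (s' ∘ (Equiv.prodComm (Fin (k + 1)) (Fin (k + 2))).symm) ∘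
          (Equiv.sumCongr (Equiv.prodComm (Fin (k + 2)) (Fin (k + 2)))
            (Equiv.prodComm (Fin (k + 1)) (Fin (k + 1)))).symm.symm)) b := by
    rw [planar_zFailureFamily_transport_eq]
    exact hb'
  have h := capacity_thresholds_add_le_half (fun k => planarHGPCode k) planarHGPCode_k_pos _ DX ha hb'
  linarith

open Classical in
/-- **`p₀(3) ≤ p_c ≤ 1/4`** for the planar codes' code-capacity accuracy threshold (first sector) under any family
of minimum-weight decoders (`p₀(3) = (3-2√2)/6 ≈ .0286`; numerics: optimal `≈ .109`, MWPM `≈ .103` — VALIDATED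
values, not theorems). [cite: DumerKovalevPryadko2015, p. 5 (p_Zc* ≈ 0.029); RichardsonUrbanke2008, Lemma 4.78] -/
theorem planar_z_capacity_accuracyThreshold_mem (D : ∀ k, Decoder (PlanarCheck k → ZMod 2) (PlanarQubit k → ZMod 2))
    (hD : ∀ k, (D k).IsMinWeight (fun e => planarHX k *ᵥ e) {x | planarHX k *ᵥ x = 0} hammingNorm) :
    thresholdValue 3 ≤ accuracyThreshold (planarFailureFamily D) ∧
      accuracyThreshold (planarFailureFamily D) ≤ 1 / 4 :=
  ⟨le_accuracyThreshold (planar_isThresholdLowerBound D hD) ((thresholdValue_le_half 3).trans (by norm_num)),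
    planar_z_capacity_threshold_le_quarter D (isThresholdLowerBound_accuracyThreshold _)⟩

open Classical in
/-- **`p_c ≤ 1/4` for EVERY decoder family**, accuracy-threshold form, first sector.
[cite: RichardsonUrbanke2008, Lemma 4.78 (Erasure Decomposition Lemma)] -/
theorem planar_z_capacity_accuracyThreshold_le_quarter
    (DZ : ∀ k, Decoder (PlanarCheck k → ZMod 2) (PlanarQubit k → ZMod 2)) :
    accuracyThreshold (planarFailureFamily DZ) ≤ 1 / 4 :=
  planar_z_capacity_threshold_le_quarter DZ (isThresholdLowerBound_accuracyThreshold _)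

open Classical in
/-- **`p_c ≤ 1/4` for EVERY decoder family**, accuracy-threshold form, second sector.
[cite: RichardsonUrbanke2008, Lemma 4.78 (Erasure Decomposition Lemma)] -/
theorem planar_x_capacity_accuracyThreshold_le_quarter
    (DX : ∀ k, Decoder (PlanarZCheck k → ZMod 2) (PlanarQubit k → ZMod 2)) :
    accuracyThreshold (planarFailureFamily' DX) ≤ 1 / 4 :=
  planar_x_capacity_threshold_le_quarter DX (isThresholdLowerBound_accuracyThreshold _)

/-- **`(3/2)·p₀(3) ≤ p_c^depol ≤ 3/8` for the planar surface codes** under sector-wise minimum-weight decoding — a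
certified two-sided interval. [cite: DennisEtAl2002, §4.1 and §4.6; DumerKovalevPryadko2015, Thm 2 (w = 4)] -/
theorem planar_depolarizing_accuracyThreshold_mem
    (DX : ∀ k, Decoder (PlanarZCheck k → ZMod 2) (PlanarQubit k → ZMod 2))
    (DZ : ∀ k, Decoder (PlanarCheck k → ZMod 2) (PlanarQubit k → ZMod 2))
    (hDX : ∀ k, (DX k).IsMinWeight (fun e => planarHZ k *ᵥ e) {x | planarHZ k *ᵥ x = 0} hammingNorm)
    (hDZ : ∀ k, (DZ k).IsMinWeight (fun e => planarHX k *ᵥ e) {x | planarHX k *ᵥ x = 0} hammingNorm) :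
    3 / 2 * thresholdValue 3 ≤ accuracyThreshold (depolarizingFailureFamily (fun k => planarHGPCode k) DX DZ) ∧
      accuracyThreshold (depolarizingFailureFamily (fun k => planarHGPCode k) DX DZ) ≤ 3 / 8 := by
  refine ⟨le_accuracyThreshold (planar_depolarizing_isThresholdLowerBound DX DZ hDX hDZ) ?_,
    depolarizingAccuracyThreshold_le_three_eighths (fun k => planarHGPCode k) planarHGPCode_k_pos DX DZ⟩
  have := thresholdValue_le_half (3 : ℝ)
  linarith

end Planar

/-! ### Toric codes: the `X`-sector code-capacity ceiling -/

section Toric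

/-- The toric code is a re-indexing of its exchange (the inverse direction of `toricHGPCode_swap_eq_reindex`).
[cite: KovalevPryadko2012, Example 6 (toric codes as hypergraph products)] -/
theorem toricHGPCode_eq_swap_reindex (k : ℕ) :
    toricHGPCode k =
      (toricHGPCode k).swap.reindex (Equiv.prodComm (Fin (k + 2)) (Fin (k + 2))).symm
        (Equiv.prodComm (Fin (k + 2)) (Fin (k + 2))).symm
        (Equiv.sumCongr (Equiv.prodComm (Fin (k + 2)) (Fin (k + 2)))
          (Equiv.prodComm (Fin (k + 2)) (Fin (k + 2)))).symm :=
  CSSCode.eq_reindex_of_submatrix (C := (toricHGPCode k).swap) (C' := toricHGPCode k)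
    (toricHGPCode_HX_eq_submatrix k) (toricHGPCode_HZ_eq_submatrix k)

open Classical in
/-- **Transport back** for the toric codes: every `X`-decoder family yields a `Z`-decoder family with the same
failure family. [cite: StaceBarrettDoherty2009, p. 2 (X̄ and Z̄ enter symmetrically)] -/
theorem toricHGP_zFailureFamily_transport_eq
    (DX : ∀ k, Decoder ((Fin (k + 2) × Fin (k + 2)) → ZMod 2)
      (((Fin (k + 2) × Fin (k + 2)) ⊕ (Fin (k + 2) × Fin (k + 2))) → ZMod 2)) :
    zFailureFamily (fun k => toricHGPCode k)
        (fun k => fun s' => DX k (s' ∘ (Equiv.prodComm (Fin (k + 2)) (Fin (k + 2))).symm) ∘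
          (Equiv.sumCongr (Equiv.prodComm (Fin (k + 2)) (Fin (k + 2)))
            (Equiv.prodComm (Fin (k + 2)) (Fin (k + 2)))).symm.symm) =
      xFailureFamily (fun k => toricHGPCode k) DX := by
  funext k p
  rw [xFailureFamily_eq_swap]
  have key := CSSCode.zFailure_reindex (toricHGPCode k).swap (Equiv.prodComm (Fin (k + 2)) (Fin (k + 2))).symm
    (Equiv.prodComm (Fin (k + 2)) (Fin (k + 2))).symm
    (Equiv.sumCongr (Equiv.prodComm (Fin (k + 2)) (Fin (k + 2)))
      (Equiv.prodComm (Fin (k + 2)) (Fin (k + 2)))).symm (DX k) p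
  rw [← toricHGPCode_eq_swap_reindex] at key
  exact key

open Classical in
/-- **Toric code-capacity threshold `≤ 1/4` for EVERY decoder family, `X`-sector** (independent bit flips; the
`Z`-sector is `toricHGP_z_capacity_threshold_le_quarter`). [cite: RichardsonUrbanke2008, Lemma 4.78 (Erasure Decomposition Lemma); StaceBarrettDoherty2009, p. 2] -/
theorem toricHGP_x_capacity_threshold_le_quarter
    (DX : ∀ k, Decoder ((Fin (k + 2) × Fin (k + 2)) → ZMod 2)
      (((Fin (k + 2) × Fin (k + 2)) ⊕ (Fin (k + 2) × Fin (k + 2))) → ZMod 2))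
    {b : ℝ} (hb : IsThresholdLowerBound (xFailureFamily (fun k => toricHGPCode k) DX) b) : b ≤ 1 / 4 := by
  have ha : IsThresholdLowerBound (zFailureFamily (fun k => toricHGPCode k)
      (fun k => fun s' => DX k (s' ∘ (Equiv.prodComm (Fin (k + 2)) (Fin (k + 2))).symm) ∘
          (Equiv.sumCongr (Equiv.prodComm (Fin (k + 2)) (Fin (k + 2)))
            (Equiv.prodComm (Fin (k + 2)) (Fin (k + 2)))).symm.symm)) b := by
    rw [toricHGP_zFailureFamily_transport_eq]
    exact hb
  have h := capacity_thresholds_add_le_half (fun k => toricHGPCode k) toricHGPCode_k_pos _ DX ha hb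
  linarith

open Classical in
/-- **`p₀(3) ≤ p_c ≤ 1/4`, `X`-sector of the toric codes**, any family of minimum-weight `X`-decoders.
[cite: DumerKovalevPryadko2015, p. 5 (p_c* ≈ 0.029); RichardsonUrbanke2008, Lemma 4.78] -/
theorem toricHGP_x_capacity_accuracyThreshold_mem
    (D : ∀ k, Decoder ((Fin (k + 2) × Fin (k + 2)) → ZMod 2)
      (((Fin (k + 2) × Fin (k + 2)) ⊕ (Fin (k + 2) × Fin (k + 2))) → ZMod 2))
    (hD : ∀ k, (D k).IsMinWeight (toricHGPCode k).xSyndrome ((toricHGPCode k).kerZ : Set _) hammingNorm) :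
    thresholdValue 3 ≤ accuracyThreshold (xFailureFamily (fun k => toricHGPCode k) D) ∧
      accuracyThreshold (xFailureFamily (fun k => toricHGPCode k) D) ≤ 1 / 4 :=
  ⟨le_accuracyThreshold (toricHGP_x_isThresholdLowerBound D hD) ((thresholdValue_le_half 3).trans (by norm_num)),
    toricHGP_x_capacity_threshold_le_quarter D (isThresholdLowerBound_accuracyThreshold _)⟩

open Classical in
/-- **`p_c ≤ 1/4` for EVERY decoder family**, accuracy-threshold form, `X`-sector of the toric codes.
[cite: RichardsonUrbanke2008, Lemma 4.78 (Erasure Decomposition Lemma)] -/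
theorem toricHGP_x_capacity_accuracyThreshold_le_quarter
    (DX : ∀ k, Decoder ((Fin (k + 2) × Fin (k + 2)) → ZMod 2)
      (((Fin (k + 2) × Fin (k + 2)) ⊕ (Fin (k + 2) × Fin (k + 2))) → ZMod 2)) :
    accuracyThreshold (xFailureFamily (fun k => toricHGPCode k) DX) ≤ 1 / 4 :=
  toricHGP_x_capacity_threshold_le_quarter DX (isThresholdLowerBound_accuracyThreshold _)

end Toric

end Summit.Ventures.QEC.Thresholds
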